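import Summits.Ventures.PercRepro.SixThreeTriple

/-!
# PercRepro — the exact pair bound for an independent triple, part B: the count `D(T ∪ {x, x′}) ≤ 15` and the share `≥ 1/15` (p2, gen 6)

Continuation of `SixThreeTriple.lean` (split for the 400-line file limit; proofs unchanged).
-/

namespace PercRepro

namespace SixThree

open Finset ThmH

variable {α : Type*} [DecidableEq α] {M : Matroid α} [M.Finite]

/-- The coplanar lines of `M|T` with respect to `{x, x′}`. -/
noncomputable def coplanarLines (M : Matroid α) [M.Finite] (T : Finset α) (x x' : α) : Finset (Finset α) :=
  (linesOf M T).filter (fun L => x' ∈ clF M (insert x L))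

/-- **The line part of the triple count**: the planes `P ≠ G` with a rank-`2` trace on `T` contribute at most
`6 · |C| + 2 · (3 − |C|) = 6 + 4|C|`, `C` the coplanar lines. -/
theorem sum_rank_two_le_triple (hs : Simple M) {G T : Finset α} (hG : G ∈ planes M) (hT : T ⊆ G)
    (hrT : M.eRk (T : Set α) = 3) (hT3 : T.card = 3) {x x' : α} (hx : x ∈ gr M) (hx' : x' ∈ gr M)
    (hxx' : x ≠ x') (hxG : x ∉ G) (hx'G : x' ∉ G) :
    ∑ P ∈ (planesOf M G (insert x (insert x' T))).filter (fun P => M.eRk ((P ∩ T : Finset α) : Set α) = 2),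
      fRule M P (insert x (insert x' T)) ≤ 6 + 4 * ((coplanarLines M T x x').card : ℚ) := by
  classical
  have hTg : T ⊆ gr M := hT.trans (mem_planes.1 hG).1
  obtain ⟨hcard3, hk⟩ := linesOf_triple hs hTg hrT hT3
  set S := insert x (insert x' T) with hS
  set A₂ := (planesOf M G S).filter (fun P => M.eRk ((P ∩ T : Finset α) : Set α) = 2) with hA₂
  have hA₂data : ∀ P ∈ A₂, P ∈ planes M ∧ P ≠ G ∧ M.eRk ((S ∩ P : Finset α) : Set α) = 3 ∧
      M.eRk ((P ∩ T : Finset α) : Set α) = 2 := by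
    intro P hP
    rw [hA₂, Finset.mem_filter, planesOf, Finset.mem_filter, Finset.mem_erase] at hP
    exact ⟨hP.1.1.2, hP.1.1.1, hP.1.2, hP.2⟩
  have hmaps : ∀ P ∈ A₂, clF M (P ∩ T) ∈ linesOf M T := by
    intro P hP
    obtain ⟨hPpl, hne, -, h2⟩ := hA₂data P hP
    obtain ⟨hL, hLB, -, -⟩ := line_of_trace hG hPpl hT hrT h2
    unfold linesOf
    rw [Finset.mem_filter, hLB]
    exact ⟨hL, two_le_card_of_eRk_eq_two h2⟩
  rw [← Finset.sum_fiberwise_of_maps_to hmaps]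
  -- per line: `≤ 2 + (4 if coplanar)`
  have hfib : ∀ L ∈ linesOf M T, ∑ P ∈ A₂.filter (fun P => clF M (P ∩ T) = L), fRule M P S ≤
      2 + (if L ∈ coplanarLines M T x x' then (4 : ℚ) else 0) := by
    intro L hL
    have hLG := linesOf_subset_plane hs hG hT hrT hL
    have hL' : L ∈ lines M := (Finset.mem_filter.1 hL).1
    have hLcard : 2 ≤ (L ∩ T).card := (Finset.mem_filter.1 hL).2
    have hF : ∀ P ∈ A₂.filter (fun P => clF M (P ∩ T) = L), P ∈ planes M ∧ P ≠ G ∧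
        M.eRk ((S ∩ P : Finset α) : Set α) = 3 ∧ P ∩ T = L ∩ T ∧ L ⊆ P := by
      intro P hP
      rw [Finset.mem_filter] at hP
      obtain ⟨hPpl, hne, hr3, h2⟩ := hA₂data P hP.1
      obtain ⟨-, hLB, -, hLP⟩ := line_of_trace hG hPpl hT hrT h2
      rw [hP.2] at hLB hLP
      exact ⟨hPpl, hne, hr3, hLB.symm, hLP⟩
    by_cases hcop : L ∈ coplanarLines M T x x'
    · rw [if_pos hcop]
      have h := (pair_fibre_le hs hG hT hrT hL' hLG hLcard hx hx' hxx' hxG hx'G _ hF).1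
      rw [hk L hL] at h
      norm_num at h ⊢
      linarith
    · rw [if_neg hcop]
      have hnb : ∀ P ∈ A₂.filter (fun P => clF M (P ∩ T) = L), ¬ ({x, x'} : Finset α) ⊆ P := by
        intro P hP hsub
        apply hcop
        obtain ⟨hPpl, -, -, -, hLP⟩ := hF P hP
        have hc' : 2 ≤ L.card := hLcard.trans (Finset.card_le_card Finset.inter_subset_left)
        have hPeq : P = clF M (insert x L) :=
          plane_eq_clF_insert hs hPpl hL' hLP hLG hc' hx hxG (hsub (by simp))
        unfold coplanarLines
        rw [Finset.mem_filter]
        exact ⟨hL, hPeq ▸ hsub (by simp)⟩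
      have h := pair_fibre_le_of_no_both hs hG hT hL' hLG hLcard hx hx' hxx' hxG hx'G _ hF hnb
      rw [hk L hL] at h
      norm_num at h ⊢
      linarith
  calc ∑ L ∈ linesOf M T, ∑ P ∈ A₂.filter (fun P => clF M (P ∩ T) = L), fRule M P S
      ≤ ∑ L ∈ linesOf M T, (2 + (if L ∈ coplanarLines M T x x' then (4 : ℚ) else 0)) :=
        Finset.sum_le_sum hfib
    _ = 6 + 4 * ((coplanarLines M T x x').card : ℚ) := by
        have hinter : linesOf M T ∩ coplanarLines M T x x' = coplanarLines M T x x' := by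
          unfold coplanarLines
          exact Finset.inter_eq_right.2 (Finset.filter_subset _ _)
        rw [Finset.sum_add_distrib, Finset.sum_const, hcard3, Finset.sum_ite_mem, hinter, Finset.sum_const,
          nsmul_eq_mul, nsmul_eq_mul]
        push_cast
        ring

/-- **The point part of the triple count**: the planes `P ≠ G` with `|P ∩ T| ≤ 1` and a rank-`3` trace on `S` each
contribute `1` and inject into the points of `T` lying on no coplanar line. -/
theorem sum_rank_le_one_le_triple (hs : Simple M) {G T : Finset α} (hG : G ∈ planes M) (hT : T ⊆ G)
    (hrT : M.eRk (T : Set α) = 3) {x x' : α} (hx : x ∈ gr M) (hxx' : x ≠ x') (hxG : x ∉ G) :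
    ∑ P ∈ (planesOf M G (insert x (insert x' T))).filter (fun P => ¬ M.eRk ((P ∩ T : Finset α) : Set α) = 2),
      fRule M P (insert x (insert x' T)) ≤
      ((T.filter (fun a => ∀ L ∈ coplanarLines M T x x', a ∉ L)).card : ℚ) := by
  classical
  have hTg : T ⊆ gr M := hT.trans (mem_planes.1 hG).1
  set S := insert x (insert x' T) with hS
  set A₁ := (planesOf M G S).filter (fun P => ¬ M.eRk ((P ∩ T : Finset α) : Set α) = 2) with hA₁
  have hA₁data : ∀ P ∈ A₁, P ∈ planes M ∧ P ≠ G ∧ M.eRk ((S ∩ P : Finset α) : Set α) = 3 ∧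
      (P ∩ T).card ≤ 1 := by
    intro P hP
    rw [hA₁, Finset.mem_filter, planesOf, Finset.mem_filter, Finset.mem_erase] at hP
    obtain ⟨⟨⟨hne, hPpl⟩, hr3⟩, hnot2⟩ := hP
    refine ⟨hPpl, hne, hr3, ?_⟩
    apply card_le_one_of_eRk_le_one hs (Finset.inter_subset_right.trans hTg)
    have hle2 := eRk_inter_le_two hG hPpl hne hT
    obtain ⟨k, hk, -⟩ := eRk_eq_nat M (P ∩ T)
    rw [hk] at hle2 hnot2 ⊢
    have hk2 : k ≤ 2 := by exact_mod_cast hle2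
    have hk2' : k ≠ 2 := fun h => hnot2 (by rw [h]; rfl)
    exact_mod_cast (show k ≤ 1 by omega)
  -- each such plane has trace exactly `{a, x, x′}` for a point `a ∈ T` on no coplanar line
  have hA₁trace : ∀ P ∈ A₁, (S ∩ P).card = 3 ∧
      ∃ a ∈ T.filter (fun a => ∀ L ∈ coplanarLines M T x x', a ∉ L), S ∩ P = insert a {x, x'} := by
    intro P hP
    obtain ⟨hPpl, hne, hr3, hcard1⟩ := hA₁data P hP
    have hsub : S ∩ P ⊆ (P ∩ T) ∪ {x, x'} := by
      rw [hS, pair_trace_eq]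
      exact Finset.union_subset_union (Finset.Subset.refl _) Finset.inter_subset_right
    have hle3 : (S ∩ P).card ≤ 3 := by
      calc (S ∩ P).card ≤ ((P ∩ T) ∪ {x, x'}).card := Finset.card_le_card hsub
        _ ≤ (P ∩ T).card + ({x, x'} : Finset α).card := Finset.card_union_le _ _
        _ ≤ 1 + 2 := by rw [Finset.card_pair hxx']; omega
    have hge3 : 3 ≤ (S ∩ P).card := three_le_card_of_eRk_eq_three hr3
    have hcard3 : (S ∩ P).card = 3 := le_antisymm hle3 hge3
    refine ⟨hcard3, ?_⟩
    obtain ⟨a, ha⟩ : (P ∩ T).Nonempty := by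
      rw [Finset.nonempty_iff_ne_empty]
      intro hempty
      have : S ∩ P ⊆ ({x, x'} : Finset α) := by
        intro y hy
        have := hsub hy
        rw [hempty, Finset.empty_union] at this
        exact this
      have := Finset.card_le_card this
      rw [Finset.card_pair hxx'] at this
      omega
    have hPT : P ∩ T = {a} := by
      apply Finset.eq_singleton_iff_unique_mem.2 ⟨ha, ?_⟩
      intro y hy
      exact Finset.card_le_one.1 hcard1 y hy a ha
    have hSP : S ∩ P = insert a {x, x'} := by
      apply Finset.eq_of_subset_of_card_le
      · rw [hPT] at hsub
        intro y hy
        have := hsub hy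
        rw [Finset.mem_union, Finset.mem_singleton] at this
        rw [Finset.mem_insert]
        exact this
      · rw [hcard3]
        exact Finset.card_le_three
    refine ⟨a, ?_, hSP⟩
    rw [Finset.mem_filter]
    refine ⟨(Finset.mem_inter.1 ha).2, ?_⟩
    intro L hL haL
    have hL' : L ∈ linesOf M T := (Finset.mem_filter.1 hL).1
    have hcop : x' ∈ clF M (insert x L) := (Finset.mem_filter.1 hL).2
    exact no_point_plane_of_coplanar hs hG hT hrT hL' hx hxG hcop hPpl hr3 haL hSP hcard1
  have hterm : ∀ P ∈ A₁, fRule M P S = 1 := by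
    intro P hP
    obtain ⟨-, -, hr3, -⟩ := hA₁data P hP
    obtain ⟨hcard3, -⟩ := hA₁trace P hP
    unfold fRule
    rw [if_pos hr3, hcard3]
    norm_num
  have hA₁sub : A₁ ⊆ (T.filter (fun a => ∀ L ∈ coplanarLines M T x x', a ∉ L)).image
      (fun a => clF M (insert a {x, x'})) := by
    intro P hP
    obtain ⟨hPpl, -, hr3, -⟩ := hA₁data P hP
    obtain ⟨-, a, haF, hSP⟩ := hA₁trace P hP
    rw [Finset.mem_image]
    refine ⟨a, haF, ?_⟩
    apply Finset.coe_injective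
    rw [coe_clF]
    have hsubP : insert a {x, x'} ⊆ P := by rw [← hSP]; exact Finset.inter_subset_right
    have hr3' : M.eRk ((insert a {x, x'} : Finset α) : Set α) = 3 := by rw [← hSP]; exact hr3
    exact closure_eq_of_subset_plane hPpl hsubP hr3'
  calc ∑ P ∈ A₁, fRule M P S = ∑ _P ∈ A₁, (1 : ℚ) := Finset.sum_congr rfl hterm
    _ = (A₁.card : ℚ) := by rw [Finset.sum_const, nsmul_eq_mul, mul_one]
    _ ≤ _ := by
        have h1 := Finset.card_le_card hA₁sub
        have h2 := Finset.card_image_le (s := T.filter (fun a => ∀ L ∈ coplanarLines M T x x', a ∉ L))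
          (f := fun a => clF M (insert a {x, x'}))
        exact_mod_cast h1.trans h2

/-- The points of `T` on no coplanar line: at most `1` if some line is coplanar, none if two lines are. -/
theorem card_free_le (hs : Simple M) {G T : Finset α} (hG : G ∈ planes M) (hT : T ⊆ G)
    (hrT : M.eRk (T : Set α) = 3) (hT3 : T.card = 3) {x x' : α} :
    (1 ≤ (coplanarLines M T x x').card →
      (T.filter (fun a => ∀ L ∈ coplanarLines M T x x', a ∉ L)).card ≤ 1) ∧
    (2 ≤ (coplanarLines M T x x').card →
      (T.filter (fun a => ∀ L ∈ coplanarLines M T x x', a ∉ L)).card = 0) := by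
  classical
  have hTg : T ⊆ gr M := hT.trans (mem_planes.1 hG).1
  obtain ⟨-, hk⟩ := linesOf_triple hs hTg hrT hT3
  have hCsub : coplanarLines M T x x' ⊆ linesOf M T := Finset.filter_subset _ _
  refine ⟨?_, ?_⟩
  · intro h1
    obtain ⟨L, hL⟩ := Finset.card_pos.1 h1
    have hsub : T.filter (fun a => ∀ L ∈ coplanarLines M T x x', a ∉ L) ⊆ T \ L := by
      intro a ha
      rw [Finset.mem_filter] at ha
      rw [Finset.mem_sdiff]
      exact ⟨ha.1, ha.2 L hL⟩
    have hcard : (T \ L).card = 1 := by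
      have h := Finset.card_sdiff_add_card_inter T L
      rw [Finset.inter_comm, hk L (hCsub hL), hT3] at h
      omega
    exact (Finset.card_le_card hsub).trans hcard.le
  · intro h2
    obtain ⟨L₁, hL₁, L₂, hL₂, hne⟩ := Finset.one_lt_card.1 h2
    have hL₁' : L₁ ∈ lines M := (Finset.mem_filter.1 (hCsub hL₁)).1
    have hL₂' : L₂ ∈ lines M := (Finset.mem_filter.1 (hCsub hL₂)).1
    -- the two traces are distinct pairs of the triple `T`, so they cover `T`
    have hinter : (L₁ ∩ T ∩ (L₂ ∩ T)).card ≤ 1 := by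
      by_contra h
      push Not at h
      obtain ⟨u, hu, v, hv, huv⟩ := Finset.one_lt_card.1 h
      simp only [Finset.mem_inter] at hu hv
      exact hne (lines_eq_of_two_mem hs hL₁' hL₂' hu.1.1 hv.1.1 hu.2.1 hv.2.1 huv)
    have hcover : (L₁ ∩ T) ∪ (L₂ ∩ T) = T := by
      apply Finset.eq_of_subset_of_card_le (Finset.union_subset Finset.inter_subset_right Finset.inter_subset_right)
      have h := Finset.card_union_add_card_inter (L₁ ∩ T) (L₂ ∩ T)
      rw [hk L₁ (hCsub hL₁), hk L₂ (hCsub hL₂)] at h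
      omega
    rw [Finset.card_eq_zero, Finset.filter_eq_empty_iff]
    intro a ha hfree
    have : a ∈ (L₁ ∩ T) ∪ (L₂ ∩ T) := by rw [hcover]; exact ha
    rw [Finset.mem_union, Finset.mem_inter, Finset.mem_inter] at this
    rcases this with ⟨h, -⟩ | ⟨h, -⟩
    · exact hfree L₁ hL₁ h
    · exact hfree L₂ hL₂ h

/-- **The exact pair bound for an independent triple** (mine-2 §19.2 (c) at `b = 3`, the `≤` half): for `T ⊆ G` an
independent triple and `x ≠ x′ ∉ G`, `D(T ∪ {x, x′}) ≤ 15`. -/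
theorem D_pair_le_triple (hs : Simple M) {G T : Finset α} (hG : G ∈ planes M) (hT : T ⊆ G)
    (hrT : M.eRk (T : Set α) = 3) (hT3 : T.card = 3) {x x' : α} (hx : x ∈ gr M) (hx' : x' ∈ gr M)
    (hxx' : x ≠ x') (hxG : x ∉ G) (hx'G : x' ∉ G) :
    D M (insert x (insert x' T)) ≤ 15 := by
  classical
  unfold D
  rw [← Finset.add_sum_erase (planes M) _ hG, fRule_eq_of_inter (pair_inter_eq hT hxG hx'G) hrT,
    sum_erase_eq_sum_planesOf, hT3, ← Finset.sum_filter_add_sum_filter_not (planesOf M G _)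
      (fun P => M.eRk ((P ∩ T : Finset α) : Set α) = 2)]
  have h2 := sum_rank_two_le_triple hs hG hT hrT hT3 hx hx' hxx' hxG hx'G
  have h1 := sum_rank_le_one_le_triple hs hG hT hrT hx hxx' hxG
  obtain ⟨hf1, hf2⟩ := card_free_le hs hG hT hrT hT3 (x := x) (x' := x')
  have hC2 : (coplanarLines M T x x').card ≤ 2 := by
    by_contra h
    push Not at h
    have hCsub : coplanarLines M T x x' ⊆ linesOf M T := Finset.filter_subset _ _
    have hcard3 := (linesOf_triple hs (hT.trans (mem_planes.1 hG).1) hrT hT3).1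
    have hCeq : coplanarLines M T x x' = linesOf M T :=
      Finset.eq_of_subset_of_card_le hCsub (by omega)
    apply not_all_coplanar hs hG hT hrT hT3 hx hx' hxx' hxG
    intro L hL
    rw [← hCeq] at hL
    exact (Finset.mem_filter.1 hL).2
  have hfree3 : (T.filter (fun a => ∀ L ∈ coplanarLines M T x x', a ∉ L)).card ≤ 3 :=
    (Finset.card_le_card (Finset.filter_subset _ _)).trans hT3.le
  set s2 := ∑ P ∈ (planesOf M G (insert x (insert x' T))).filter
    (fun P => M.eRk ((P ∩ T : Finset α) : Set α) = 2), fRule M P (insert x (insert x' T)) with hs2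
  set s1 := ∑ P ∈ (planesOf M G (insert x (insert x' T))).filter
    (fun P => ¬ M.eRk ((P ∩ T : Finset α) : Set α) = 2), fRule M P (insert x (insert x' T)) with hs1
  set fr := (T.filter (fun a => ∀ L ∈ coplanarLines M T x x', a ∉ L)).card with hfr
  obtain ⟨c, hc⟩ : ∃ c, (coplanarLines M T x x').card = c := ⟨_, rfl⟩
  rw [hc] at h2 hf1 hf2 hC2
  have hfr3 : (fr : ℚ) ≤ 3 := by exact_mod_cast hfree3
  norm_num
  interval_cases c
  · push_cast at h2
    linarith
  · have : (fr : ℚ) ≤ 1 := by exact_mod_cast hf1 (le_refl _)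
    push_cast at h2
    linarith
  · have : (fr : ℚ) = 0 := by exact_mod_cast hf2 (le_refl _)
    push_cast at h2
    linarith

/-- **The exact lossy-pair share for a triple**: `w(G, T ∪ {x, x′}) ≥ 1/15` (mine-2 §19.4 (iii), the `≥` half). -/
theorem share_triple_pair_ge (hs : Simple M) {G T : Finset α} (hG : G ∈ planes M) (hT : T ⊆ G)
    (hrT : M.eRk (T : Set α) = 3) (hT3 : T.card = 3) {x x' : α} (hx : x ∈ gr M) (hx' : x' ∈ gr M)
    (hxx' : x ≠ x') (hxG : x ∉ G) (hx'G : x' ∉ G) :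
    (1 / 15 : ℚ) ≤ fRule M G (insert x (insert x' T)) / D M (insert x (insert x' T)) := by
  have hSG := pair_inter_eq hT hxG hx'G
  rw [fRule_eq_of_inter hSG hrT]
  obtain ⟨-, hDpos⟩ := D_pos hG hSG hrT
  have hD := D_pair_le_triple hs hG hT hrT hT3 hx hx' hxx' hxG hx'G
  rw [hT3, le_div_iff₀ hDpos]
  norm_num
  linarith

end SixThree

end PercRepro
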